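import Summits.QuantumFields.YangMills.Theorems.BalabanUVNodesN15KingModelCoverAllTorons
import Summits.QuantumFields.YangMills.Theorems.BalabanUVNodesN15KingModelRungUnit
import HarnessLib

/-!
# BalabanUVNodes ∕ N15 — THE KING-MODEL RUNG (PART Ͻ-k): NE2⁺'s UNIT-LATTICE LAYER AT LIVE FLAT BACKGROUNDS — the typed hypothesis shape `T4EtaRate.NE2PlusUnit` (the node's unit
# layer, [B9] Thm 3.15 (3.187) template with King's clean rate `θ^k`) IS INHABITED, HYPOTHESIS-FREE, by the real and imaginary parts of King's toron block-field covariance difference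
# `(Δ^{(K+1)}_ω)⁻¹ − (Δ^{(K)}_{ω^L})⁻¹` on a family of paired instances whose BACKGROUNDS ARE THE TORONS (every unit phase vector; `avg = ω ↦ ω^L`), with `(δ₀, a₀, B₀, θ) =
# (κ_m∕4, 1, C_diff·K_{d+1}(κ_m∕4) + 1, L⁻¹)` uniform in the volume, the level AND THE BACKGROUND — PART Ͻ-j by name
# (Track A, DAG node N15 = NE2; FAN-OUT v1.1 §N15 s3 «KING-MODEL RUNG … NE2's analogue DECIDED in the model … + what the curved case adds»; count-neutral)

HONEST FRAMING.  Count-neutral (cell `pub-ymgap`, seat `pub-ymgap-dag-n15-e` g45; `--supports stmt-QuantumFields-27247 --as helper` = K3ᴬ, KEY MAP v3).  A MODEL INHABITATION of the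
cell's typed NE2⁺ unit-layer shape: the carriers are the King-model family of the g0 rung (`kingVol L j = 2L^m` per direction, `KingVolIndex`, operator geometry `torusOpGeo`) with the
one-point backgrounds `pt9Bg` REPLACED by the torons `toronBg` (configurations = unit phase vectors = constant abelian link fields on the fine torus, `one = 1`, pointwise product, ALL
regularity predicates `True` — every flat field is regular); the kernel is King's `A = 0`-model block-field covariance at the toron (PART Ͷ-k `effLapTw`), split into real and imaginary
parts (the typed kernels are real-valued).  This is NE2⁺'s unit layer DECIDED IN KING's MODEL AT EVERY FLAT `U(1)` BACKGROUND — not Bałaban's `C^{(k)}(Λ)` of Thm 3.15 at curved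
non-abelian backgrounds ([Balaban1985BackgroundPropagators] (3.187) untouched), NOT a node discharge (N15 of record untouched — discharged by n15-a); nothing continuum ∕ ℝ⁴ ∕ OS ∕ Clay.

PROVED HERE:
* §1 `toronBg d : B9.Backgrounds` (def), `toronCoarsen` (`ω ↦ ω^L`, def), `toronPairing` (def; the g0 identity pairing of runs `K`, `K+1` with `avg = toronCoarsen L`), `toronVolInstance d L :
  KingVolIndex d → PairedInstance` (def), `toronVolInstance_gc_k`;
* §2 `toronBlockCovDiff` (def: the complex difference kernel), `toronBlockCovRe`∕`toronBlockCovIm` (defs: the typed site kernels), `toronUnitDist` (def: King's `tdistT`), ★★ `norm_toronBlockCovDiff_le`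
  (PART Ͻ-j `norm_effLapTw_inv_sub_apply_le_rate_all` at `n = 1` BY NAME), `abs_re_le_norm'`∕`abs_im_le_norm'`;
* §3 ★★★ **`etaRateIneqUnit_toronBlockCovRe`** ∕ **`_Im`** (for EVERY index and EVERY toron `U`: `EtaRateIneqUnit … (C_tor + 1) (κ_m∕4) L⁻¹ K U`), ★★★★ **`ne2PlusUnit_toronBlockCovRe`** ∕ **`_Im`**
  (`NE2PlusUnit c35 (toronVolInstance d L) (toronBlockCovRe L a m²) (fun _ _ => True) (toronUnitDist L)` HYPOTHESIS-FREE for `L ≥ 2`, `a, m² > 0`, every `c35`), `ne2ZeroUnit_toronBlockCovRe`∕`_Im`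
  (the `U ≡ 1` member), ★★★ `ne2PlusUnit_toron_package`.
PRIOR TREE ART (by name): Ͻ-j (`norm_effLapTw_inv_sub_apply_le_rate_all`), the g0 rung (`KingVolIndex`, `kingVol`, `kingVol_neZero`), `T4EtaRate` (`PairedInstance`, `EtaPairing`, `EtaRateIneqUnit`,
`NE2PlusUnit`), `T4EtaRateUnitWitness` (`NE2ZeroUnit`, `ne2ZeroUnit_of_ne2PlusUnit`), `T4EtaRateOperatorTorus.torusOpGeo`, `B9` (`Backgrounds`, `SiteKernel`), `King1986.Torus` (`tdistT`, `CdiffM`,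
`kapM`, `CdiffM_nonneg`, `kapM_pos_le`), `B4Sect5Proof.latticeConst`∕`latticeConst_nonneg`.  Dedup (rg at filing): basename 0 files; needles `toronBg|toronVolInstance|toronBlockCovRe|
ne2PlusUnit_toron` 0 tree files.  presearch: n/a (typed inhabitation by composition).  Locators: [Balaban1985BackgroundPropagators] Thm 3.15 (3.187) p.432 (quantifier template), (3.35)–(3.36)
p.396 (regularity conditions — trivially met by flat fields in the model); [King1986] Lemma 4.5 (4.38) p.674, (4.39)–(4.41) pp.674–675, p.664 (pairing convention).  0 `sorry`, 9 `def` (incl. `toronConst`).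
-/

noncomputable section

open scoped BigOperators ComplexConjugate ComplexOrder
open Finset Matrix

namespace Summit.QuantumFields.YangMills.BalabanUVNodes.N15KingModelRung.Cover

open Literature.MathematicalPhysics.QuantumFieldTheory.Balaban1983to89
open Literature.MathematicalPhysics.QuantumFieldTheory.Balaban1983to89.T4EtaRate (PairedInstance EtaPairing EtaRateIneqUnit NE2PlusUnit)
open Literature.MathematicalPhysics.QuantumFieldTheory.Balaban1983to89.T4EtaRateUnitWitness (NE2ZeroUnit ne2ZeroUnit_of_ne2PlusUnit)
open Literature.MathematicalPhysics.QuantumFieldTheory.Balaban1983to89.T4EtaRateOperatorTorus (torusOpGeo)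
open Literature.MathematicalPhysics.QuantumFieldTheory.Balaban1983to89.B5Prop11Plancherel (Tor)
open Literature.MathematicalPhysics.QuantumFieldTheory.Balaban1983to89.B4Sect5Proof (latticeConst latticeConst_nonneg)
open Literature.MathematicalPhysics.QuantumFieldTheory.King1986 (aK)
open Literature.MathematicalPhysics.QuantumFieldTheory.King1986.Torus (tdistT CdiffM kapM CdiffM_nonneg kapM_pos_le)
open Summit.QuantumFields.YangMills.BalabanUVNodes.N15KingModelRung (KingVolIndex kingVol kingVol_neZero)
open Summit.QuantumFields.YangMills.BalabanUVNodes.N15KingModelRung.Toron (effLapTw)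

variable {d : ℕ}

/-! ## §1 The toron backgrounds and the toron-volume paired instances -/

/-- THE TORON BACKGROUNDS: configurations = unit phase vectors `ω` (constant abelian link fields `U(x,μ) = ω_μ` on the fine torus), `one = 1`, pointwise product; ALL regularity ∕
complex-extension predicates are `True` (flat fields satisfy (3.35)–(3.36) trivially in the model). [cite: Balaban1985BackgroundPropagators, (3.35)–(3.36) p.396 (the predicates' slots)] -/
@[reducible] def toronBg (d : ℕ) : B9.Backgrounds where
  Cfg := {ω : Fin (d + 1) → ℂ // ∀ μ, ‖ω μ‖ = 1}
  one := ⟨fun _ => 1, fun _ => by simp⟩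
  mul := fun ω ω' => ⟨fun μ => ω.1 μ * ω'.1 μ, fun μ => by rw [norm_mul, ω.2 μ, ω'.2 μ, mul_one]⟩
  Reg335 := fun _ _ _ => True
  Reg336 := fun _ _ _ => True
  Cplx337 := fun _ _ _ => True
  Cplx338 := fun _ _ _ => True

/-- READING A FINE TORON AT THE NEXT COARSER SPACING: `ω ↦ ω^L` (`L` fine links of phase `ω_μ` make one coarser link). [cite: King1986, p.664 (pairing convention)] -/
def toronCoarsen (L : ℕ) (ω : (toronBg d).Cfg) : (toronBg d).Cfg := ⟨fun μ => ω.1 μ ^ L, fun μ => by rw [norm_pow, ω.2 μ, one_pow]⟩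

/-- `toronCoarsen L 1 = 1`. [folklore] -/
theorem toronCoarsen_one (L : ℕ) : toronCoarsen (d := d) L (toronBg d).one = (toronBg d).one := by
  apply Subtype.ext; funext μ; simp [toronCoarsen]

/-- THE TORON PAIRING of the runs `K`, `K+1` on the same operator carrier: the g0 identity pairing of `T4EtaRateOperatorTorus.torusOpPairing` on sites and test functions, with the
backgrounds averaged by `toronCoarsen L`. [cite: King1986, p.664 (pairing convention)] -/
def toronPairing {L : ℝ} (hL : L ≠ 0) (Ln : ℕ) (M : ℝ) (k : ℕ) (N : Fin (d + 1) → ℕ) [∀ μ, NeZero (N μ)] :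
    EtaPairing (torusOpGeo d L M k N) (torusOpGeo d L M (k + 1) N) (toronBg d) (toronBg d) where
  n := 1
  k_eq := rfl
  L_eq := rfl
  M_eq := rfl
  eta_eq := by
    show (L ^ (k + 1))⁻¹ * L ^ 1 = (L ^ k)⁻¹
    rw [pow_one, pow_succ, mul_inv, mul_assoc, inv_mul_cancel₀ hL, mul_one]
  ι := fun y => y
  scale_ι := fun _ => rfl
  dist_ι := fun _ _ => rfl
  τ := fun lam => lam
  suppIn_τ := fun _ _ h => h
  supNorm_τ := fun _ => le_rfl
  avg := toronCoarsen Ln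
  avg_one := toronCoarsen_one Ln

/-- THE TORON-VOLUME FAMILY OF PAIRED INSTANCES: the King-model carriers of the g0 rung (unit torus `Π_μℤ∕(2L^m)`, runs `K`, `K+1`, size letter `Msz`) WITH TORON BACKGROUNDS.
[cite: King1986, p.664 (pairing convention); Balaban1985BackgroundPropagators, (3.41)–(3.42) p.397 (carrier conventions)] -/
def toronVolInstance (d L : ℕ) [NeZero L] : KingVolIndex d → PairedInstance := fun j =>
  haveI := kingVol_neZero L j
  { gc := torusOpGeo d (L : ℝ) j.Msz j.K (kingVol L j)
    gf := torusOpGeo d (L : ℝ) j.Msz (j.K + 1) (kingVol L j)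
    Bc := toronBg d
    Bf := toronBg d
    pair := toronPairing (Nat.cast_ne_zero.mpr (NeZero.ne L)) L j.Msz j.K (kingVol L j) }

/-- The coarse run of the index has `K` scales. [folklore] -/
theorem toronVolInstance_gc_k (L : ℕ) [NeZero L] (j : KingVolIndex d) : (toronVolInstance d L j).gc.k = j.K := rfl

/-! ## §2 The kernel: King's toron block-field covariance difference, real and imaginary parts -/

section Kernel

variable (L : ℕ) [NeZero L]

/-- THE TWO-SPACING DIFFERENCE OF KING's BLOCK-FIELD COVARIANCE AT THE TORON `ω` (finer spacing `L^{−K−1}`, phases `ω`; coarser spacing `L^{−K}`, phases `ω^L`) at unit sites `b, b′` of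
the index's torus. [cite: King1986, Lemma 4.5 (4.38) p.674, (4.39)–(4.41) pp.674–675] -/
def toronBlockCovDiff (a m2 : ℝ) (j : KingVolIndex d) (ω : (toronBg d).Cfg) (b b' : Tor (kingVol L j)) : ℂ :=
  haveI := kingVol_neZero L j
  (effLapTw (L ^ 1 * L ^ j.K) (kingVol L j) (aK a L (j.K + 1)) (((L ^ 1 * L ^ j.K : ℕ) : ℝ) ^ 2) m2 ω.1)⁻¹ b b'
    - (effLapTw (L ^ j.K) (kingVol L j) (aK a L j.K) (((L ^ j.K : ℕ) : ℝ) ^ 2) m2 (fun μ => ω.1 μ ^ (L ^ 1)))⁻¹ b b'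

/-- The REAL PART of the toron difference as the typed unit-layer site kernel on the toron-volume family. [cite: Balaban1985BackgroundPropagators, Thm 3.15 (3.187) p.432 (shape)] -/
def toronBlockCovRe (a m2 : ℝ) : ∀ j : KingVolIndex d, B9.SiteKernel (toronVolInstance d L j).gc (toronVolInstance d L j).Bf :=
  fun j => ⟨fun ω b b' => (toronBlockCovDiff L a m2 j ω b b').re⟩

/-- The IMAGINARY PART of the toron difference as the typed unit-layer site kernel. [cite: Balaban1985BackgroundPropagators, Thm 3.15 (3.187) p.432 (shape)] -/
def toronBlockCovIm (a m2 : ℝ) : ∀ j : KingVolIndex d, B9.SiteKernel (toronVolInstance d L j).gc (toronVolInstance d L j).Bf :=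
  fun j => ⟨fun ω b b' => (toronBlockCovDiff L a m2 j ω b b').im⟩

/-- `unitDist :=` King's unit-torus distance `tdistT`. [cite: King1986, Lemma 4.5 (4.38) p.674] -/
def toronUnitDist : ∀ j : KingVolIndex d, (toronVolInstance d L j).gc.Site → (toronVolInstance d L j).gc.Site → ℝ :=
  fun j y y' =>
    haveI := kingVol_neZero L j
    tdistT (kingVol L j) y y'

/-- The constant of the inhabitation: `C_tor = C_diff·K_{d+1}(κ_m∕4)`. [cite: King1986, (4.41) p.675] -/
def toronConst (d : ℕ) (a m2 : ℝ) (L : ℕ) : ℝ := CdiffM (d + 1) a m2 L * latticeConst (d + 1) (kapM (d + 1) a m2 L / 4)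

omit [NeZero L] in
/-- `C_tor ≥ 0`. [folklore] -/
theorem toronConst_nonneg (hL : 2 ≤ L) {a m2 : ℝ} (ha : 0 < a) (hm : 0 < m2) : 0 ≤ toronConst d a m2 L := by
  have hκ := (kapM_pos_le (d := d + 1) ha hm hL).1
  exact mul_nonneg (CdiffM_nonneg (d := d + 1) ha hm hL) (latticeConst_nonneg _ (by positivity))

/-- ★★ **THE TORON DIFFERENCE IS BOUNDED AT EVERY TORON** (PART Ͻ-j at `n = 1` by name): `‖ΔC_ω(b,b′)‖ ≤ C_diff·(L^K)⁻¹·K_{d+1}(κ_m∕4)·e^{−(κ_m∕4)d(b,b′)}` for every index, every unit `ω`.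
[cite: King1986, Lemma 4.5 (4.38) p.674, (4.39)–(4.41) pp.674–675] -/
theorem norm_toronBlockCovDiff_le (hL : 2 ≤ L) {a m2 : ℝ} (ha : 0 < a) (hm : 0 < m2) (j : KingVolIndex d) (ω : (toronBg d).Cfg) (b b' : Tor (kingVol L j)) :
    haveI := kingVol_neZero L j
    ‖toronBlockCovDiff L a m2 j ω b b'‖
      ≤ CdiffM (d + 1) a m2 L * ((L : ℝ) ^ j.K)⁻¹
          * (latticeConst (d + 1) (kapM (d + 1) a m2 L / 4) * Real.exp (-(kapM (d + 1) a m2 L / 4 * tdistT (kingVol L j) b b'))) := by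
  haveI := kingVol_neZero L j
  exact norm_effLapTw_inv_sub_apply_le_rate_all (M := kingVol L j) ha hm hL j.one_le_K le_rfl ω.2 b b'

end Kernel

/-! ## §3 The typed unit-layer inequality and `NE2PlusUnit` at live flat backgrounds -/

section Typed

variable (L : ℕ) [NeZero L]

/-- The common step: a real quantity dominated by the toron difference obeys the typed unit inequality's right-hand side. [folklore] -/
theorem typed_bound_of_le_norm (hL : 2 ≤ L) {a m2 : ℝ} (ha : 0 < a) (hm : 0 < m2) (j : KingVolIndex d) (ω : (toronBg d).Cfg) (b b' : Tor (kingVol L j))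
    {r : ℝ} (hr : |r| ≤ ‖toronBlockCovDiff L a m2 j ω b b'‖) :
    haveI := kingVol_neZero L j
    |r| ≤ (toronConst d a m2 L + 1) * Real.exp (-(kapM (d + 1) a m2 L / 4 * tdistT (kingVol L j) b b')) * ((L : ℝ)⁻¹) ^ j.K := by
  haveI := kingVol_neZero L j
  have h := hr.trans (norm_toronBlockCovDiff_le L hL ha hm j ω b b')
  have hexp := Real.exp_pos (-(kapM (d + 1) a m2 L / 4 * tdistT (kingVol L j) b b'))
  have hLK : 0 ≤ ((L : ℝ) ^ j.K)⁻¹ := by positivity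
  have hC := toronConst_nonneg (d := d) L hL ha hm
  rw [inv_pow]
  calc |r| ≤ CdiffM (d + 1) a m2 L * ((L : ℝ) ^ j.K)⁻¹
          * (latticeConst (d + 1) (kapM (d + 1) a m2 L / 4) * Real.exp (-(kapM (d + 1) a m2 L / 4 * tdistT (kingVol L j) b b'))) := h
    _ = toronConst d a m2 L * Real.exp (-(kapM (d + 1) a m2 L / 4 * tdistT (kingVol L j) b b')) * ((L : ℝ) ^ j.K)⁻¹ := by
        unfold toronConst; ring
    _ ≤ (toronConst d a m2 L + 1) * Real.exp (-(kapM (d + 1) a m2 L / 4 * tdistT (kingVol L j) b b')) * ((L : ℝ) ^ j.K)⁻¹ := by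
        gcongr; linarith

/-- ★★★ **THE TYPED UNIT INEQUALITY FOR THE REAL PART, AT EVERY TORON**: for EVERY index and EVERY background `U` of the toron family,
`EtaRateIneqUnit (toronBlockCovRe L a m² j) (fun _ => True) (toronUnitDist L j) (C_tor + 1) (κ_m∕4) L⁻¹ K U`. [cite: Balaban1985BackgroundPropagators, Thm 3.15 (3.187) p.432 (shape); King1986, Lemma 4.5 (4.38) p.674] -/
theorem etaRateIneqUnit_toronBlockCovRe (hL : 2 ≤ L) {a m2 : ℝ} (ha : 0 < a) (hm : 0 < m2) (j : KingVolIndex d) (U : (toronVolInstance d L j).Bf.Cfg) :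
    EtaRateIneqUnit (toronBlockCovRe L a m2 j) (fun _ => True) (toronUnitDist L j) (toronConst d a m2 L + 1) (kapM (d + 1) a m2 L / 4) ((L : ℝ)⁻¹) j.K U := by
  intro y y' _ _
  exact typed_bound_of_le_norm L hL ha hm j U y y' (Complex.abs_re_le_norm _)

/-- ★★★ **THE TYPED UNIT INEQUALITY FOR THE IMAGINARY PART, AT EVERY TORON.** [cite: Balaban1985BackgroundPropagators, Thm 3.15 (3.187) p.432 (shape); King1986, Lemma 4.5 (4.38) p.674] -/
theorem etaRateIneqUnit_toronBlockCovIm (hL : 2 ≤ L) {a m2 : ℝ} (ha : 0 < a) (hm : 0 < m2) (j : KingVolIndex d) (U : (toronVolInstance d L j).Bf.Cfg) :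
    EtaRateIneqUnit (toronBlockCovIm L a m2 j) (fun _ => True) (toronUnitDist L j) (toronConst d a m2 L + 1) (kapM (d + 1) a m2 L / 4) ((L : ℝ)⁻¹) j.K U := by
  intro y y' _ _
  exact typed_bound_of_le_norm L hL ha hm j U y y' (Complex.abs_im_le_norm _)

/-- ★★★★ **`NE2PlusUnit` IS INHABITED AT LIVE FLAT BACKGROUNDS — REAL PART**: `NE2PlusUnit c35 (toronVolInstance d L) (toronBlockCovRe L a m²) (fun _ _ => True) (toronUnitDist L)` with
`(δ₀, a₀, B₀, θ) = (κ_m∕4, 1, C_tor + 1, L⁻¹)`, HYPOTHESIS-FREE (`L ≥ 2`, `a, m² > 0`, every `c35`), uniform in the volume, the level AND THE TORON.  HONEST SCOPE: King's `A = 0`-model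
block-field covariance `(Δ^{(K)})⁻¹` at constant abelian link fields; not Bałaban's `C^{(k)}(Λ)`. [cite: Balaban1985BackgroundPropagators, Thm 3.15 (3.187) p.432 (quantifier template); King1986, Lemma 4.5 (4.38) p.674] -/
theorem ne2PlusUnit_toronBlockCovRe (hL : 2 ≤ L) {a m2 : ℝ} (ha : 0 < a) (hm : 0 < m2) (c35 : ℝ) :
    NE2PlusUnit c35 (toronVolInstance d L) (toronBlockCovRe L a m2) (fun _ _ => True) (toronUnitDist L) := by
  have hLpos : (0 : ℝ) < L := by exact_mod_cast (lt_of_lt_of_le zero_lt_two hL)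
  have hθ1 : (L : ℝ)⁻¹ < 1 := inv_lt_one_of_one_lt₀ (by exact_mod_cast hL)
  have hC : 0 < toronConst d a m2 L + 1 := by linarith [toronConst_nonneg (d := d) L hL ha hm]
  have hκ := (kapM_pos_le (d := d + 1) ha hm hL).1
  exact ⟨kapM (d + 1) a m2 L / 4, 1, toronConst d a m2 L + 1, (L : ℝ)⁻¹, by positivity, one_pos, hC, inv_pos.mpr hLpos, hθ1,
    fun j _ _ _ U _ _ => etaRateIneqUnit_toronBlockCovRe L hL ha hm j U⟩

/-- ★★★★ **`NE2PlusUnit` IS INHABITED AT LIVE FLAT BACKGROUNDS — IMAGINARY PART** (same constants). [cite: Balaban1985BackgroundPropagators, Thm 3.15 (3.187) p.432 (quantifier template); King1986, Lemma 4.5 (4.38) p.674] -/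
theorem ne2PlusUnit_toronBlockCovIm (hL : 2 ≤ L) {a m2 : ℝ} (ha : 0 < a) (hm : 0 < m2) (c35 : ℝ) :
    NE2PlusUnit c35 (toronVolInstance d L) (toronBlockCovIm L a m2) (fun _ _ => True) (toronUnitDist L) := by
  have hLpos : (0 : ℝ) < L := by exact_mod_cast (lt_of_lt_of_le zero_lt_two hL)
  have hθ1 : (L : ℝ)⁻¹ < 1 := inv_lt_one_of_one_lt₀ (by exact_mod_cast hL)
  have hC : 0 < toronConst d a m2 L + 1 := by linarith [toronConst_nonneg (d := d) L hL ha hm]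
  have hκ := (kapM_pos_le (d := d + 1) ha hm hL).1
  exact ⟨kapM (d + 1) a m2 L / 4, 1, toronConst d a m2 L + 1, (L : ℝ)⁻¹, by positivity, one_pos, hC, inv_pos.mpr hLpos, hθ1,
    fun j _ _ _ U _ _ => etaRateIneqUnit_toronBlockCovIm L hL ha hm j U⟩

/-- `NE2ZeroUnit` for the real part (the `U ≡ 1` member of the toron family; sizes `Msz ≥ 1 > 0`, trivial regularity). [cite: King1986, (4.41) p.675 (A = 0 model)] -/
theorem ne2ZeroUnit_toronBlockCovRe (hL : 2 ≤ L) {a m2 : ℝ} (ha : 0 < a) (hm : 0 < m2) :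
    NE2ZeroUnit (toronVolInstance d L) (toronBlockCovRe L a m2) (fun _ _ => True) (toronUnitDist L) :=
  ne2ZeroUnit_of_ne2PlusUnit (c35 := 0) (fun j => lt_of_lt_of_le one_pos j.one_le_Msz) (fun _ _ _ => trivial) (fun _ _ _ => trivial)
    (ne2PlusUnit_toronBlockCovRe L hL ha hm 0)

/-- `NE2ZeroUnit` for the imaginary part. [cite: King1986, (4.41) p.675 (A = 0 model)] -/
theorem ne2ZeroUnit_toronBlockCovIm (hL : 2 ≤ L) {a m2 : ℝ} (ha : 0 < a) (hm : 0 < m2) :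
    NE2ZeroUnit (toronVolInstance d L) (toronBlockCovIm L a m2) (fun _ _ => True) (toronUnitDist L) :=
  ne2ZeroUnit_of_ne2PlusUnit (c35 := 0) (fun j => lt_of_lt_of_le one_pos j.one_le_Msz) (fun _ _ _ => trivial) (fun _ _ _ => trivial)
    (ne2PlusUnit_toronBlockCovIm L hL ha hm 0)

/-- ★★★ **PACKAGE — NE2⁺'s UNIT LAYER DECIDED IN KING's MODEL AT EVERY FLAT `U(1)` BACKGROUND**: both parts of the toron block-field covariance difference inhabit `NE2PlusUnit` and
`NE2ZeroUnit` on the toron-volume family, hypothesis-free. [cite: Balaban1985BackgroundPropagators, Thm 3.15 (3.187) p.432 (shape); King1986, Lemma 4.5 (4.38) p.674] -/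
theorem ne2PlusUnit_toron_package (hL : 2 ≤ L) {a m2 : ℝ} (ha : 0 < a) (hm : 0 < m2) (c35 : ℝ) :
    NE2PlusUnit c35 (toronVolInstance d L) (toronBlockCovRe L a m2) (fun _ _ => True) (toronUnitDist L) ∧
    NE2PlusUnit c35 (toronVolInstance d L) (toronBlockCovIm L a m2) (fun _ _ => True) (toronUnitDist L) ∧
    NE2ZeroUnit (toronVolInstance d L) (toronBlockCovRe L a m2) (fun _ _ => True) (toronUnitDist L) ∧
    NE2ZeroUnit (toronVolInstance d L) (toronBlockCovIm L a m2) (fun _ _ => True) (toronUnitDist L) :=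
  ⟨ne2PlusUnit_toronBlockCovRe L hL ha hm c35, ne2PlusUnit_toronBlockCovIm L hL ha hm c35, ne2ZeroUnit_toronBlockCovRe L hL ha hm, ne2ZeroUnit_toronBlockCovIm L hL ha hm⟩

end Typed

end Summit.QuantumFields.YangMills.BalabanUVNodes.N15KingModelRung.Cover

end
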